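import Summits.ABC.StewartYu.PadicW80ParLC
import HarnessLib

/-!
# The `(log p)`-normalised parameter record `PadicW80ParL` — part D of the inequalities

Support file (theorems only; no named facts), cell `abc-stewartyu` (p1, stub S5 of memo-03 §4): twin of
`PadicW80ParD.lean` on the `ℓ`-normalised record. `X/h + 1 ≤ e^{7G}` (one more `e^G` than landed: the class
price `Mcl ≤ e^ℓ ≤ e^G` sits in `U`), `log((X+h)/h) ≤ 7G`; the sizes vector `Vall`, ranges `Lall`; the inner step
`t_J = ⌊(T/2ᴶ)/(2m)⌋` with `t_J ≥ 1`, `2m t_J ≤ T/2ᴶ`; the node counts `kpts = 2^{k+J}S₀/2` and the products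
**`(31/32)·2ᵏ𝔘/ℓ ≤ kpts·t_J ≤ 2ᵏ𝔘/ℓ`** (`KT_ge`, `KT_le`) — the `(log p)`-normalised zero count; the count of odd
nodes. Proofs are the landed ones; design note HOME/p1/S5-logp-ledger.md. [cite: Waldschmidt1980, §3.2–3.5 (pp. 264–274)]
[cite: Yu1990, (2.31) (p. 36)]
-/

noncomputable section

open Finset Real
open Literature.NumberTheory.Transcendental Literature.NumberTheory.Transcendental.Waldschmidt1980

namespace Summit.ABC.StewartYu

open PadicW80Par (cTp cSp cLp cLp' Ap mRp)

namespace PadicW80ParL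

variable {d : ℕ} (P : PadicW80ParL d)

/-- **`X/h + 1 ≤ e^{7G}`**: with `h > W⋆/G`,
`X/h ≤ 33 U G/(c_L' m V_θ W⋆) ≤ Mcl · Aᵐ m^{2m+3} (∏Vⱼ) G² ≤ e^{G} e^{3G} e^{G} e^{G}`
(`nV ≤ V`, `nV_θ ≤ V_θ`, `nG ≤ G`, `Mcl ≤ e^ℓ ≤ e^G`). [folklore] -/
theorem Xpt_div_hpar_le : P.Xptℓ / P.hparℓ + 1 ≤ Real.exp (7 * P.Gℓ) := by
  have hh := P.hpar_pos; have hG := P.G_pos; have hW := P.one_le_Wstar; have hm := two_le_mR P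
  have hm0 := mR_pos P; have hVf := P.hVmax1; have hVθ := P.hVθ1; have hV1 := P.one_le_prodVs
  have hM := P.hMcl
  -- Step 1: `X/h ≤ X G / W⋆`
  have h1 : P.Xptℓ / P.hparℓ ≤ P.Xptℓ * P.Gℓ / P.Wstarℓ := by
    rw [div_le_div_iff₀ hh (by linarith)]
    have := P.Wstar_div_G_lt_hpar
    rw [div_lt_iff₀ hG] at this
    have hX := P.Xpt_nonneg
    nlinarith
  -- Step 2: `X G/W⋆ ≤ Mcl Ap^m m^{2m+3} (∏V) G²`
  have h2 : P.Xptℓ * P.Gℓ / P.Wstarℓ ≤ P.Mcl * (Ap ^ (d + 1) * mRp d ^ (2 * d + 3) * (∏ j, P.V j) * P.Gℓ ^ 2) := by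
    have hX := P.Xpt_le
    rw [div_le_iff₀ (by linarith)]
    have hfac : (1 : ℝ) ≤ (d + 1).factorial := by exact_mod_cast Nat.one_le_iff_ne_zero.mpr (Nat.factorial_ne_zero _)
    have hUeq : P.Uℓ = P.Mcl * Ap ^ (d + 1) * (mRp d ^ (2 * d + 3) / (d + 1).factorial) * ((∏ j, P.nV j) * P.nVθ) *
        P.Wstarℓ * P.nGℓ := rfl
    unfold cLp' at hX
    rw [le_div_iff₀ (by positivity)] at hX
    have hA : (0 : ℝ) ≤ Ap ^ (d + 1) := by unfold Ap; positivity
    have hprod : (∏ j, P.nV j) ≤ ∏ j, P.V j :=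
      prod_le_prod (fun j _ => le_trans zero_le_one (P.one_le_nV j)) fun j _ => P.nV_le j
    have hnVθ : P.nVθ ≤ P.Vθ := P.nVθ_le
    have hnG : P.nGℓ ≤ P.Gℓ := by unfold nGℓ; exact div_le_self hG.le P.hℓ
    have hnV0 : 0 ≤ ∏ j, P.nV j := le_trans zero_le_one P.one_le_prodnV
    have hnVθ0 : 0 ≤ P.nVθ := le_trans zero_le_one P.one_le_nVθ
    have hnG0 : 0 ≤ P.nGℓ := P.nG_pos.le
    have key : P.Xptℓ * (2 ^ 12 * mRp d * P.Vθ) * P.Gℓ ≤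
        33 * (P.Mcl * (Ap ^ (d + 1) * mRp d ^ (2 * d + 3) * (∏ j, P.V j) * P.Gℓ ^ 2) * P.Wstarℓ * P.Vθ) := by
      have hdiv : mRp d ^ (2 * d + 3) / (d + 1).factorial ≤ mRp d ^ (2 * d + 3) := div_le_self (by positivity) hfac
      calc P.Xptℓ * (2 ^ 12 * mRp d * P.Vθ) * P.Gℓ ≤ 33 * P.Uℓ * P.Gℓ := by nlinarith
        _ = 33 * (P.Mcl * (Ap ^ (d + 1) * (mRp d ^ (2 * d + 3) / (d + 1).factorial) * (∏ j, P.nV j) *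
              (P.nGℓ * P.Gℓ)) * P.Wstarℓ * P.nVθ) := by rw [hUeq]; ring
        _ ≤ 33 * (P.Mcl * (Ap ^ (d + 1) * mRp d ^ (2 * d + 3) * (∏ j, P.V j) * (P.Gℓ * P.Gℓ)) * P.Wstarℓ * P.Vθ) := by
            gcongr
        _ = 33 * (P.Mcl * (Ap ^ (d + 1) * mRp d ^ (2 * d + 3) * (∏ j, P.V j) * P.Gℓ ^ 2) * P.Wstarℓ * P.Vθ) := by ring
    have h33 : 33 * P.Vθ ≤ 2 ^ 12 * mRp d * P.Vθ := by nlinarith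
    have hZ : 0 ≤ P.Mcl * (Ap ^ (d + 1) * mRp d ^ (2 * d + 3) * (∏ j, P.V j) * P.Gℓ ^ 2) * P.Wstarℓ := by positivity
    nlinarith [mul_le_mul_of_nonneg_left h33 (mul_nonneg hZ P.G_pos.le), P.Xpt_nonneg]
  -- Step 3: the exponential bounds
  have f1 := P.A_pow_mul_le
  have f3 := P.prodV_le_exp_G
  have f4 := P.G_sq_le_exp_G
  have f0 : P.Mcl ≤ Real.exp P.Gℓ := by
    have h1 : Real.log P.Mcl ≤ P.Gℓ := P.hMclℓ.trans P.ℓ_le_G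
    calc P.Mcl = Real.exp (Real.log P.Mcl) := (Real.exp_log (by linarith)).symm
      _ ≤ Real.exp P.Gℓ := Real.exp_le_exp.mpr h1
  have h3 : P.Mcl * (Ap ^ (d + 1) * mRp d ^ (2 * d + 3) * (∏ j, P.V j) * P.Gℓ ^ 2) ≤ Real.exp (6 * P.Gℓ) := by
    calc P.Mcl * (Ap ^ (d + 1) * mRp d ^ (2 * d + 3) * (∏ j, P.V j) * P.Gℓ ^ 2)
        = P.Mcl * ((Ap ^ (d + 1) * mRp d ^ (2 * d + 3)) * (∏ j, P.V j) * P.Gℓ ^ 2) := by ring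
      _ ≤ Real.exp P.Gℓ * (Real.exp (3 * P.Gℓ) * Real.exp P.Gℓ * Real.exp P.Gℓ) := by
          have : (0 : ℝ) ≤ Ap ^ (d + 1) * mRp d ^ (2 * d + 3) := by unfold Ap; positivity
          gcongr
      _ = Real.exp (6 * P.Gℓ) := by simp only [← Real.exp_add]; ring_nf
  have h4 : Real.exp (6 * P.Gℓ) + 1 ≤ Real.exp (7 * P.Gℓ) := by
    have hG1 := P.one_le_G
    have e : Real.exp (7 * P.Gℓ) = Real.exp (6 * P.Gℓ) * Real.exp P.Gℓ := by rw [← Real.exp_add]; ring_nf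
    rw [e]
    have h2e : 2 ≤ Real.exp P.Gℓ := by
      have := Real.add_one_le_exp P.Gℓ; linarith
    have h5 : 1 ≤ Real.exp (6 * P.Gℓ) := Real.one_le_exp (by positivity)
    nlinarith
  linarith [h1, h2, h3, h4]

/-- **`log((X + h)/h) ≤ 7 G`.** [cite: Waldschmidt1980, (3.13)–(3.14) (p. 265)] -/
theorem log_Xpt_div_le : Real.log ((P.Xptℓ + P.hparℓ) / P.hparℓ) ≤ 7 * P.Gℓ := by
  have hh := P.hpar_pos
  have e : (P.Xptℓ + P.hparℓ) / P.hparℓ = P.Xptℓ / P.hparℓ + 1 := by field_simp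
  rw [e]
  have h := P.Xpt_div_hpar_le
  have hpos : 0 < P.Xptℓ / P.hparℓ + 1 := by have := P.Xpt_nonneg; positivity
  calc Real.log (P.Xptℓ / P.hparℓ + 1) ≤ Real.log (Real.exp (7 * P.Gℓ)) := Real.log_le_log hpos h
    _ = 7 * P.Gℓ := Real.log_exp _


/-! ## Part C: sizes vector, inner step, nodes (twins of `Waldschmidt1980Sizes/Numeric`) -/

/-- `Vall (castSucc j) = V j`. [folklore] -/
@[simp] theorem Vall_castSucc (j : Fin d) : P.Vallℓ (Fin.castSucc j) = P.V j := by
  unfold Vallℓ; rw [Fin.snoc_castSucc]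

/-- `Vall last = V_θ`. [folklore] -/
@[simp] theorem Vall_last : P.Vallℓ (Fin.last d) = P.Vθ := by
  unfold Vallℓ; rw [Fin.snoc_last]

/-- `Lall (castSucc j) = L j`. [folklore] -/
@[simp] theorem Lall_castSucc (j : Fin d) : P.Lallℓ (Fin.castSucc j) = P.Lℓ j := by
  unfold Lallℓ; rw [Fin.snoc_castSucc]

/-- `Lall last = L_θ`. [folklore] -/
@[simp] theorem Lall_last : P.Lallℓ (Fin.last d) = P.Lθℓ := by
  unfold Lallℓ; rw [Fin.snoc_last]

/-- `1 ≤ Vallᵢ`. [folklore] -/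
theorem one_le_Vall (i : Fin (d + 1)) : 1 ≤ P.Vallℓ i := by
  refine Fin.lastCases ?_ (fun j => ?_) i
  · rw [P.Vall_last]; exact P.hVθ1
  · rw [P.Vall_castSucc]; exact P.hV j

/-- `0 < Vallᵢ`. [folklore] -/
theorem Vall_pos (i : Fin (d + 1)) : 0 < P.Vallℓ i := lt_of_lt_of_le one_pos (P.one_le_Vall i)

/-! ### The inner step size `t_J = ⌊(T/2ᴶ)/(2m)⌋` -/

/-- `2^J ≤ L_θ` for `J < J₀` (`2^{J₀} ≤ 2 L_θ`). [folklore] -/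
theorem two_pow_le_Lθ {J : ℕ} (hJ : J < P.J₀ℓ) : 2 ^ J ≤ P.Lθℓ := by
  have h := P.two_pow_le
  have : 2 ^ (J + 1) ≤ 2 ^ P.J₀ℓ := Nat.pow_le_pow_right two_pos hJ
  rw [pow_succ] at this
  omega

/-- **`T/2ᴶ ≥ 2¹¹ m²`** for `J < J₀` (`T ≥ 2¹¹ m² nV_θ L_θ ≥ 2¹¹ m² 2ᴶ`). [folklore] -/
theorem TJ_ge {J : ℕ} (hJ : J < P.J₀ℓ) : 2 ^ 11 * (d + 1) ^ 2 ≤ P.Tℓ / 2 ^ J := by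
  rw [Nat.le_div_iff_mul_le (Nat.pow_pos two_pos)]
  have h := P.T_ge_Lθ
  have hL := P.two_pow_le_Lθ hJ
  have hV := P.one_le_nVθ
  have : ((2 ^ 11 * (d + 1) ^ 2 * 2 ^ J : ℕ) : ℝ) ≤ P.Tℓ := by
    refine le_trans ?_ h
    have hL' : ((2 : ℝ) ^ J) ≤ P.Lθℓ := by exact_mod_cast hL
    have e : ((2 ^ 11 * (d + 1) ^ 2 * 2 ^ J : ℕ) : ℝ) = 2 ^ 11 * mRp d ^ 2 * 2 ^ J := by
      unfold mRp; push_cast; ring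
    rw [e]
    have h0 : (0 : ℝ) ≤ 2 ^ 11 * mRp d ^ 2 := by positivity
    have hL0 : (0 : ℝ) ≤ P.Lθℓ := Nat.cast_nonneg _
    calc (2 : ℝ) ^ 11 * mRp d ^ 2 * 2 ^ J = 2 ^ 11 * mRp d ^ 2 * 1 * 2 ^ J := by ring
      _ ≤ 2 ^ 11 * mRp d ^ 2 * P.nVθ * P.Lθℓ :=
          mul_le_mul (mul_le_mul_of_nonneg_left hV h0) hL' (by positivity) (mul_nonneg h0 (by linarith))
  exact_mod_cast this

/-- `1 ≤ t_J` for `J < J₀`. [folklore] -/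
theorem one_le_tJ {J : ℕ} (hJ : J < P.J₀ℓ) : 1 ≤ P.tJℓ J := by
  unfold tJℓ
  rw [Nat.le_div_iff_mul_le (by omega)]
  have := P.TJ_ge hJ
  nlinarith

/-- `2m · t_J ≤ T/2ᴶ`. [folklore] -/
theorem tJ_mul_le (J : ℕ) : 2 * (d + 1) * P.tJℓ J ≤ P.Tℓ / 2 ^ J := by
  unfold tJℓ; rw [Nat.mul_comm]; exact Nat.div_mul_le_self _ _

/-- `t_J ≤ T`. [folklore] -/
theorem tJ_le_T (J : ℕ) : P.tJℓ J ≤ P.Tℓ :=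
  ((Nat.div_le_self _ _).trans (Nat.div_le_self _ _))

/-- `t_J ≤ T/(2ᴶ · 2m)` (real). [folklore] -/
theorem tJ_le_real (J : ℕ) : (P.tJℓ J : ℝ) ≤ P.Tℓ / (2 ^ J * (2 * mRp d)) := by
  have h1 : ((P.tJℓ J : ℕ) : ℝ) ≤ ((P.Tℓ / 2 ^ J : ℕ) : ℝ) / (2 * mRp d) := by
    unfold tJℓ
    have := Nat.cast_div_le (α := ℝ) (m := P.Tℓ / 2 ^ J) (n := 2 * (d + 1))
    have em : ((2 * (d + 1) : ℕ) : ℝ) = 2 * mRp d := by unfold mRp; push_cast; ring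
    rwa [em] at this
  have h2 : ((P.Tℓ / 2 ^ J : ℕ) : ℝ) ≤ (P.Tℓ : ℝ) / 2 ^ J := by
    have := Nat.cast_div_le (α := ℝ) (m := P.Tℓ) (n := 2 ^ J)
    push_cast at this; exact this
  have hm := mR_pos P
  calc (P.tJℓ J : ℝ) ≤ ((P.Tℓ / 2 ^ J : ℕ) : ℝ) / (2 * mRp d) := h1
    _ ≤ ((P.Tℓ : ℝ) / 2 ^ J) / (2 * mRp d) := div_le_div_of_nonneg_right h2 (by positivity)
    _ = P.Tℓ / (2 ^ J * (2 * mRp d)) := by rw [div_div]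

omit P in
/-- `⌊a/b⌋ ≥ a/b − 1` for naturals, as reals. [folklore] -/
private theorem natDiv_ge_real (a b : ℕ) (hb : 0 < b) : (a : ℝ) / b - 1 ≤ ((a / b : ℕ) : ℝ) := by
  have h := Nat.lt_div_mul_add hb (a := a)
  have hb' : (0 : ℝ) < b := by exact_mod_cast hb
  rw [div_sub_one hb'.ne', div_le_iff₀ hb']
  have : (a : ℝ) < (a / b : ℕ) * b + b := by exact_mod_cast h
  linarith

/-- `t_J ≥ T/(2ᴶ · 2m) − 2` (real). [folklore] -/
theorem tJ_ge_real (J : ℕ) : (P.Tℓ : ℝ) / (2 ^ J * (2 * mRp d)) - 2 ≤ P.tJℓ J := by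
  have hm := mR_pos P
  have h1 := natDiv_ge_real (P.Tℓ / 2 ^ J) (2 * (d + 1)) (by omega)
  have h2 := natDiv_ge_real P.Tℓ (2 ^ J) (Nat.pow_pos two_pos)
  have em : ((2 * (d + 1) : ℕ) : ℝ) = 2 * mRp d := by unfold mRp; push_cast; ring
  rw [em] at h1
  push_cast at h2
  unfold tJℓ
  have h3 : ((P.Tℓ : ℝ) / 2 ^ J - 1) / (2 * mRp d) ≤ ((P.Tℓ / 2 ^ J : ℕ) : ℝ) / (2 * mRp d) :=
    div_le_div_of_nonneg_right h2 (by positivity)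
  have h4 : (P.Tℓ : ℝ) / (2 ^ J * (2 * mRp d)) - 2 ≤ ((P.Tℓ : ℝ) / 2 ^ J - 1) / (2 * mRp d) - 1 := by
    rw [← div_div, sub_div]
    have : 1 / (2 * mRp d) ≤ 1 := by
      rw [div_le_one (by positivity)]; linarith [two_le_mR P]
    linarith
  linarith

/-- `T ≥ 𝔘/(c_T W⋆) − 1` (real). [folklore] -/
theorem T_ge_real : P.𝔘ℓ / (cTp * P.Wstarℓ) - 1 ≤ P.Tℓ := by
  unfold Tℓ
  have e : P.Uℓ / (cTp * 2 ^ (d + 1) * P.Wstarℓ) = P.𝔘ℓ / (cTp * P.Wstarℓ) := by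
    rw [P.U_eq]; unfold cTp; field_simp
  rw [e]
  have h1 := Nat.lt_floor_add_one (P.𝔘ℓ / (cTp * P.Wstarℓ))
  linarith

/-! ### The interpolation nodes `kpts = 2^{k+J} S₀ / 2` -/

/-- `2^{k+J} S₀ / 2 = 2^{k+J} ⌊c_S m nW⋆⌋` exactly (`S₀` is even). [folklore] -/
theorem kpts_eq (J k : ℕ) : 2 ^ (k + J) * P.S₀ℓ / 2 = 2 ^ (k + J) * ⌊cSp * mRp d * P.nWstarℓ⌋₊ := by
  unfold S₀ℓ
  rw [show 2 ^ (k + J) * (2 * ⌊cSp * mRp d * P.nWstarℓ⌋₊) = 2 ^ (k + J) * ⌊cSp * mRp d * P.nWstarℓ⌋₊ * 2 by ring,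
    Nat.mul_div_cancel _ two_pos]

/-- `kpts ≤ 2^{k+J} c_S m nW⋆` (real). [folklore] -/
theorem kpts_le_real (J k : ℕ) : ((2 ^ (k + J) * P.S₀ℓ / 2 : ℕ) : ℝ) ≤ 2 ^ (k + J) * (cSp * mRp d * P.nWstarℓ) := by
  rw [P.kpts_eq]; push_cast
  have := Nat.floor_le (show 0 ≤ cSp * mRp d * P.nWstarℓ by have := P.cS_mul_ge; linarith)
  gcongr

/-- `kpts ≥ 2^{k+J} (c_S m nW⋆ − 1)` (real). [folklore] -/
theorem kpts_ge_real (J k : ℕ) : 2 ^ (k + J) * (cSp * mRp d * P.nWstarℓ - 1) ≤ ((2 ^ (k + J) * P.S₀ℓ / 2 : ℕ) : ℝ) := by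
  rw [P.kpts_eq]; push_cast
  have := (Nat.lt_floor_add_one (cSp * mRp d * P.nWstarℓ)).le
  have h0 : (0 : ℝ) ≤ 2 ^ (k + J) := by positivity
  nlinarith

/-- `kpts ≤ 2^{d+J₀} S₀` for `k ≤ d`, `J ≤ J₀`. [folklore] -/
theorem kpts_le_nat {J k : ℕ} (hJ : J ≤ P.J₀ℓ) (hk : k ≤ d) : 2 ^ (k + J) * P.S₀ℓ / 2 ≤ 2 ^ (d + P.J₀ℓ) * P.S₀ℓ :=
  (Nat.div_le_self _ _).trans (Nat.mul_le_mul_right _ (Nat.pow_le_pow_right two_pos (by omega)))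

/-- **Upper bound `kpts · t_J ≤ 2ᵏ 𝔘/ℓ`** (`c_S/c_T = 2`; the `1/ℓ` of `S₀`).
[cite: Waldschmidt1980, Lemma 3.5 (p. 271)] [cite: Yu1990, (2.31) (p. 36)] -/
theorem KT_le (J k : ℕ) : ((2 ^ (k + J) * P.S₀ℓ / 2 : ℕ) : ℝ) * (P.tJℓ J : ℝ) ≤ 2 ^ k * (P.𝔘ℓ / P.ℓ) := by
  have h1 := P.kpts_le_real J k
  have h2 := P.tJ_le_real J
  have hm := mR_pos P; have hW := P.one_le_Wstar; have hT := P.T_pos; have hTW := P.TWstar_le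
  have hℓ := P.ℓ_pos
  have h0 : (0 : ℝ) ≤ ((2 ^ (k + J) * P.S₀ℓ / 2 : ℕ) : ℝ) := Nat.cast_nonneg _
  have hW0 : 0 < P.Wstarℓ := by linarith
  have hcS0 : (0 : ℝ) < cSp := by unfold cSp; norm_num
  have enW : P.nWstarℓ = P.Wstarℓ / P.ℓ := rfl
  calc ((2 ^ (k + J) * P.S₀ℓ / 2 : ℕ) : ℝ) * (P.tJℓ J : ℝ)
      ≤ (2 ^ (k + J) * (cSp * mRp d * P.nWstarℓ)) * (P.Tℓ / (2 ^ J * (2 * mRp d))) :=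
        mul_le_mul h1 h2 (Nat.cast_nonneg _) (by have := P.one_le_nWstar; positivity)
    _ = 2 ^ k * cSp * (P.Tℓ * P.Wstarℓ) / (2 * P.ℓ) := by
        rw [pow_add, enW]; field_simp
    _ ≤ 2 ^ k * cSp * (P.𝔘ℓ / cTp) / (2 * P.ℓ) := by gcongr
    _ = 2 ^ k * (P.𝔘ℓ / P.ℓ) := by unfold cSp cTp; field_simp

/-- **Lower bound `kpts · t_J ≥ (31/32)·2ᵏ 𝔘/ℓ`** for `J < J₀`.
[cite: Waldschmidt1980, Lemma 3.5 (p. 271)] [cite: Yu1990, (2.31) (p. 36)] -/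
theorem KT_ge {J : ℕ} (hJ : J < P.J₀ℓ) (k : ℕ) :
    31 / 32 * (2 ^ k * (P.𝔘ℓ / P.ℓ)) ≤ ((2 ^ (k + J) * P.S₀ℓ / 2 : ℕ) : ℝ) * (P.tJℓ J : ℝ) := by
  have h1 := P.kpts_ge_real J k
  have h2 := P.tJ_ge_real J
  have h3 := P.T_ge_real
  have hm := mR_pos P; have hm2 := two_le_mR P; have hW := P.one_le_Wstar; have hU := P.𝔘_pos
  have hℓ := P.ℓ_pos; have hℓ1 := P.hℓ; have hℓW := P.ℓ_le_Wstar
  have hcS := P.cS_mul_ge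
  have hWU := P.Wstar_le_𝔘
  -- the normalised unit `𝔘' = 𝔘/ℓ`
  set U' : ℝ := P.𝔘ℓ / P.ℓ with hU'
  have hU'0 : 0 < U' := by rw [hU']; positivity
  have enW : P.nWstarℓ = P.Wstarℓ / P.ℓ := rfl
  -- `2^{J} c_S m nW⋆ ≤ 𝔘'/2^{14}` : `2^{J} ≤ Lθ` and `Lθ S₀ ℓ ≤ 𝔘/2^14`, `S₀ ≥ c_S m nW⋆`
  have hJL : (2 : ℝ) ^ J ≤ P.Lθℓ := by exact_mod_cast P.two_pow_le_Lθ hJ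
  have hLS : (P.Lθℓ : ℝ) * P.S₀ℓ ≤ U' / 2 ^ 14 := by
    have := P.LθS₀ℓ_le
    rw [le_div_iff₀ (by norm_num)] at this
    rw [hU', le_div_iff₀ (by norm_num), le_div_iff₀ hℓ]
    have e : (P.Lθℓ : ℝ) * P.S₀ℓ * 2 ^ 14 * P.ℓ = P.Lθℓ * P.S₀ℓ * P.ℓ * 2 ^ 14 := by ring
    linarith
  have hS₀ := P.S₀_ge
  have hsmall : (2 : ℝ) ^ J * (cSp * mRp d * P.nWstarℓ) ≤ U' / 2 ^ 14 := by
    calc (2 : ℝ) ^ J * (cSp * mRp d * P.nWstarℓ) ≤ P.Lθℓ * P.S₀ℓ := mul_le_mul hJL hS₀ (by linarith) (Nat.cast_nonneg _)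
      _ ≤ U' / 2 ^ 14 := hLS
  have ht0 : (0 : ℝ) ≤ P.tJℓ J := Nat.cast_nonneg _
  -- `2^J t_J ≥ T/(2m) − 2^{J+1}`
  have h2J : (0 : ℝ) < 2 ^ J := by positivity
  have h2' : (P.Tℓ : ℝ) / (2 * mRp d) - 2 * 2 ^ J ≤ 2 ^ J * (P.tJℓ J : ℝ) := by
    have := mul_le_mul_of_nonneg_left h2 h2J.le
    have e : (2 : ℝ) ^ J * (P.Tℓ / (2 ^ J * (2 * mRp d)) - 2) = P.Tℓ / (2 * mRp d) - 2 * 2 ^ J := by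
      field_simp
    linarith
  -- the main term with `Ap = c_S m nW⋆`: `Ap · 𝔘/(c_T W⋆) = 2 m 𝔘'`
  set Ap : ℝ := cSp * mRp d * P.nWstarℓ with hA
  have hA1 : 1 ≤ Ap := le_trans (by norm_num) hcS
  have eA : Ap * (P.𝔘ℓ / (cTp * P.Wstarℓ)) = 2 * mRp d * U' := by
    rw [hA, hU', enW]; unfold cSp cTp; field_simp
  have hmain : 31 / 32 * U' ≤ (Ap - 1) * (P.Tℓ / (2 * mRp d) - 2 * 2 ^ J) := by
    -- (a) `(Ap-1) T/(2m) ≥ (Ap-1)(𝔘/(c_T W⋆) - 1)/(2m)`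
    have ha : (Ap - 1) * ((P.𝔘ℓ / (cTp * P.Wstarℓ) - 1) / (2 * mRp d)) ≤ (Ap - 1) * (P.Tℓ / (2 * mRp d)) :=
      mul_le_mul_of_nonneg_left (div_le_div_of_nonneg_right h3 (by positivity)) (by linarith)
    -- (b) expand
    have hb : (Ap - 1) * ((P.𝔘ℓ / (cTp * P.Wstarℓ) - 1) / (2 * mRp d)) =
        (2 * mRp d * U' - Ap - P.𝔘ℓ / (cTp * P.Wstarℓ) + 1) / (2 * mRp d) := by
      rw [← eA]; ring
    -- (c) the pieces
    have hc1 : (2 * mRp d * U' - Ap - P.𝔘ℓ / (cTp * P.Wstarℓ) + 1) / (2 * mRp d) =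
        U' - Ap / (2 * mRp d) - P.𝔘ℓ / (cTp * P.Wstarℓ) / (2 * mRp d) + 1 / (2 * mRp d) := by
      field_simp
    have hc2 : Ap / (2 * mRp d) = cSp * P.nWstarℓ / 2 := by rw [hA]; field_simp
    have hc3 : P.𝔘ℓ / (cTp * P.Wstarℓ) / (2 * mRp d) ≤ U' / 2 ^ 16 := by
      -- `𝔘/(c_T W⋆ 2m) ≤ 𝔘/(2^16 ℓ) = 𝔘'/2^16` as `ℓ ≤ W⋆`, `2m c_T ≥ 2^16`
      have hden : P.ℓ * (2 : ℝ) ^ 16 ≤ cTp * P.Wstarℓ * (2 * mRp d) := by unfold cTp; nlinarith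
      calc P.𝔘ℓ / (cTp * P.Wstarℓ) / (2 * mRp d) = P.𝔘ℓ / (cTp * P.Wstarℓ * (2 * mRp d)) := div_div _ _ _
        _ ≤ P.𝔘ℓ / (P.ℓ * 2 ^ 16) := div_le_div_of_nonneg_left hU.le (by positivity) hden
        _ = U' / 2 ^ 16 := by rw [hU', div_div]
    have hc4 : 0 ≤ 1 / (2 * mRp d) := by positivity
    have hWs : cSp * P.nWstarℓ / 2 ≤ U' / 2 ^ 84 := by
      rw [enW, hU']; unfold cSp
      rw [show (2 : ℝ) ^ 15 * (P.Wstarℓ / P.ℓ) / 2 = (2 ^ 14 * P.Wstarℓ) / P.ℓ by ring,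
        show P.𝔘ℓ / P.ℓ / 2 ^ 84 = (P.𝔘ℓ / 2 ^ 84) / P.ℓ by ring]
      exact div_le_div_of_nonneg_right (by linarith) hℓ.le
    -- (d) `(Ap-1) · 2 · 2^J ≤ 2 · 2^J Ap ≤ 𝔘'/2^13`
    have hd : (Ap - 1) * (2 * 2 ^ J) ≤ U' / 2 ^ 13 := by
      have : (Ap - 1) * (2 * 2 ^ J) ≤ 2 * (2 ^ J * Ap) := by nlinarith
      have h14 : 2 * (U' / 2 ^ 14) = U' / 2 ^ 13 := by ring
      rw [hA] at this ⊢; linarith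
    have htot : (Ap - 1) * (P.Tℓ / (2 * mRp d) - 2 * 2 ^ J) = (Ap - 1) * (P.Tℓ / (2 * mRp d)) - (Ap - 1) * (2 * 2 ^ J) := by ring
    rw [htot]
    have h31 : U' - U' / 2 ^ 84 - U' / 2 ^ 16 - U' / 2 ^ 13 ≥ 31 / 32 * U' := by linarith
    linarith only [ha, hb, hc1, hc2, hc3, hc4, hWs, hd, h31]
  -- positivity of the bracket, then the product bound
  have hX : 0 < P.Tℓ / (2 * mRp d) - 2 * 2 ^ J := by
    by_contra hneg
    push Not at hneg
    have : (Ap - 1) * (P.Tℓ / (2 * mRp d) - 2 * 2 ^ J) ≤ 0 := mul_nonpos_of_nonneg_of_nonpos (by linarith) hneg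
    linarith [hU'0]
  have hk1 : 2 ^ k * (Ap - 1) * 2 ^ J ≤ ((2 ^ (k + J) * P.S₀ℓ / 2 : ℕ) : ℝ) := by
    have : (2 : ℝ) ^ k * (Ap - 1) * 2 ^ J = 2 ^ (k + J) * (Ap - 1) := by rw [pow_add]; ring
    rw [this]; exact h1
  calc (31 : ℝ) / 32 * (2 ^ k * U') = 2 ^ k * (31 / 32 * U') := by ring
    _ ≤ 2 ^ k * ((Ap - 1) * (P.Tℓ / (2 * mRp d) - 2 * 2 ^ J)) := by gcongr
    _ ≤ 2 ^ k * ((Ap - 1) * (2 ^ J * (P.tJℓ J : ℝ))) := by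
        have hA0 : 0 ≤ Ap - 1 := by linarith
        have h2k : (0 : ℝ) ≤ 2 ^ k := by positivity
        exact mul_le_mul_of_nonneg_left (mul_le_mul_of_nonneg_left h2' hA0) h2k
    _ = (2 ^ k * (Ap - 1) * 2 ^ J) * (P.tJℓ J : ℝ) := by ring
    _ ≤ ((2 ^ (k + J) * P.S₀ℓ / 2 : ℕ) : ℝ) * (P.tJℓ J : ℝ) := mul_le_mul_of_nonneg_right hk1 ht0


/-! ## Part D: the endgame numbers (twin of `PadicW80Par.endgame_numbers`) -/

/-- `#{s < 2n : s odd} = n`. [folklore] -/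
private theorem card_odd_range_two_mul (n : ℕ) : ((range (2 * n)).filter Odd).card = n := by
  induction n with
  | zero => simp
  | succ n ih =>
    rw [show 2 * (n + 1) = (2 * n + 1) + 1 by ring, range_add_one, range_add_one, filter_insert, filter_insert]
    have hodd : Odd (2 * n + 1) := ⟨n, rfl⟩
    have heven : ¬ Odd (2 * n) := by rw [Nat.not_odd_iff_even]; exact ⟨n, by ring⟩
    rw [if_pos hodd, if_neg heven, card_insert_of_notMem, ih]
    simp

/-- `#{s < 2^{J₀} S₀ : s odd} = 2^{J₀} ⌊c_S m nW⋆⌋` (`S₀ = 2⌊c_S m nW⋆⌋`). [folklore] -/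
theorem card_odd_eq : ((range (2 ^ P.J₀ℓ * P.S₀ℓ)).filter Odd).card = 2 ^ P.J₀ℓ * ⌊cSp * mRp d * P.nWstarℓ⌋₊ := by
  unfold S₀ℓ
  rw [show 2 ^ P.J₀ℓ * (2 * ⌊cSp * mRp d * P.nWstarℓ⌋₊) = 2 * (2 ^ P.J₀ℓ * ⌊cSp * mRp d * P.nWstarℓ⌋₊) by ring]
  exact card_odd_range_two_mul _

end PadicW80ParL

end Summit.ABC.StewartYu

end
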